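import Mathlib.Analysis.InnerProductSpace.Calculus
import Mathlib.Analysis.InnerProductSpace.Projection.Submodule
import Mathlib.Analysis.Calculus.FDeriv.Analytic
import Mathlib.Analysis.Calculus.IteratedDeriv.Lemmas
import Mathlib.Analysis.Calculus.Deriv.Slope
import Mathlib.Analysis.Analytic.Uniqueness
import HarnessLib

/-!
# Closure of a space of analytic vectors under a one-parameter group (Harish-Chandra's
# corollary, abstract Hilbert-space form)

Topic `NumberTheory/Automorphic` (used by the Harish-Chandra correspondence for cusp forms,
`AutomorphicRepsGLIrreducibleL2Proofs` and its sequel); the content is functional analysis on a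
complex Hilbert space `E`. Let `U : ℝ → (E →L[ℂ] E)` be a one-parameter family of continuous
linear maps with `U (s + t) = U s ∘ U t` and `U 0 = id`, and `S ≤ E` a subspace such that every
`v ∈ S` has a derivative `d/dt|₀ U t v ∈ S` and an orbit `t ↦ U t v` which is real analytic on
`ℝ`. Then every `U t` maps the closure `Cl S` into itself
(`topologicalClosure_invariant_of_analyticAt`). This is the argument of Harish-Chandra 1953,
Corollary to Thm. 2 (p. 211: "`φ(π(exp X) ψ₀) = Σ (1/m!) φ(π_W(X^m) ψ₀)`, but `π_W(X^m) ψ₀ ∈ U` and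
therefore … `φ(π(x) ψ₀)` vanishes on a neighbourhood of `1` … since it is an analytic function on
`G` it follows that `φ(π(x) ψ₀) = 0` … Hahn–Banach") along one one-parameter subgroup, with
orthogonal complements in place of Hahn–Banach:

* `hasDerivAt_oneParam_of_zero` — the derivative of `t ↦ U t v` at `t` is `U t v'` if it is `v'`
  at `0` (group law and continuity of `U t`); `hasDerivAt_inner_oneParam` — hence
  `d/ds ⟪u, U s v⟫ = ⟪u, U s v'⟫`.
* `exists_iteratedDeriv_inner_oneParam_eq` — the iterated derivatives of the matrix coefficients
  `s ↦ ⟪u, U s v⟫`, `v ∈ S`, are again such matrix coefficients of vectors of `S`.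
* `eq_zero_of_iteratedDeriv_eq_zero` — a real-analytic `F : ℝ → ℂ` all of whose iterated
  derivatives vanish at `0` is zero (Taylor expansion `HasFPowerSeriesOnBall.hasSum_iteratedFDeriv`
  near `0`, identity principle on the connected line).
* `topologicalClosure_invariant_of_analyticAt` — the closure theorem: for `u ⊥ Cl S` and `v ∈ S`
  the analytic function `s ↦ ⟪u, U s v⟫` has vanishing iterated derivatives `⟪u, w_k⟫`, `w_k ∈ S`,
  at `0`, so it vanishes; thus `U t v ∈ (Cl S)ᗮᗮ = Cl S`, and `U t (Cl S) ⊆ Cl S` by continuity.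

As in `Mathlib.Analysis.InnerProductSpace.Calculus`, the real normed-space structure of `E` is a
separate instance `[NormedSpace ℝ E] [IsScalarTower ℝ ℂ E]` (to avoid a non-defeq diamond with
the structure restricted from `ℂ`, e.g. on `Lp ℂ 2 μ`). Everything here is proved.

## References

* Harish-Chandra, *Representations of a semisimple Lie group on a Banach space. I*, Trans. AMS 75
  (1953), 185–243: §7, Thm. 2 and its Corollary (pp. 209–211) [HarishChandraTAMS1953].
* M. Libine, *Introduction to Representations of Real Semisimple Lie Groups*, arXiv:1212.2578,
  Cor. 73 (the same argument for `(𝔤, K)`-submodules of admissible representations) [Libine2012].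
-/

open scoped Topology InnerProductSpace
open Filter

noncomputable section

namespace Literature.NumberTheory.Automorphic

section Hilbert

variable {E : Type*} [NormedAddCommGroup E] [InnerProductSpace ℂ E] [NormedSpace ℝ E]
  [IsScalarTower ℝ ℂ E]

/-- **Derivative of an orbit of a one-parameter family at a general point.** If `U (s + t) =
U s ∘ U t` and `t ↦ U t v` has derivative `v'` at `0`, then it has derivative `U t v'` at `t`
(`U (t + τ) v - U t v = U t (U τ v - U 0 v)` and `U t` is continuous linear).
Harish-Chandra 1953, §7 (`π(y) ψ ∈ W` for `ψ ∈ W`). [folklore] -/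
theorem hasDerivAt_oneParam_of_zero (U : ℝ → E →L[ℂ] E) (hU : ∀ s t v, U (s + t) v = U s (U t v))
    {v v' : E} (hd : HasDerivAt (fun t ↦ U t v) v' 0) (t : ℝ) :
    HasDerivAt (fun s ↦ U s v) (U t v') t := by
  rw [hasDerivAt_iff_tendsto_slope_zero] at hd ⊢
  have h := ((U t).continuous.tendsto v').comp hd
  refine h.congr fun τ ↦ ?_
  show U t (τ⁻¹ • (U (0 + τ) v - U 0 v)) = τ⁻¹ • (U (t + τ) v - U t v)
  rw [zero_add, ContinuousLinearMap.map_smul_of_tower, map_sub, ← hU, ← hU, add_zero]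

/-- **Derivative of a matrix coefficient**: under the same hypotheses,
`d/ds ⟪u, U s v⟫ = ⟪u, U s v'⟫` at every `s = t` (`HasDerivAt.inner`). [folklore] -/
theorem hasDerivAt_inner_oneParam (U : ℝ → E →L[ℂ] E) (hU : ∀ s t v, U (s + t) v = U s (U t v))
    {v v' : E} (hd : HasDerivAt (fun t ↦ U t v) v' 0) (u : E) (t : ℝ) :
    HasDerivAt (fun s ↦ ⟪u, U s v⟫_ℂ) ⟪u, U t v'⟫_ℂ t := by
  have h := (hasDerivAt_const t u).inner ℂ (hasDerivAt_oneParam_of_zero U hU hd t)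
  rwa [inner_zero_left, add_zero] at h

/-- **Iterated derivatives of matrix coefficients stay matrix coefficients.** If every `v ∈ S`
has `d/dt|₀ U t v = v' ∈ S`, then for every `k` and `v ∈ S` there is `w ∈ S` with
`(d/ds)^k ⟪u, U s v⟫ = ⟪u, U s w⟫` (induction, `iteratedDeriv_succ'`). Harish-Chandra 1953,
proof of the Corollary to Thm. 2 (`π_W(X^m) ψ₀ ∈ U`). [cite: HarishChandraTAMS1953, Cor. to Thm. 2 (p. 211)] -/
theorem exists_iteratedDeriv_inner_oneParam_eq (U : ℝ → E →L[ℂ] E)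
    (hU : ∀ s t v, U (s + t) v = U s (U t v)) (S : Submodule ℂ E)
    (hS : ∀ v ∈ S, ∃ v' ∈ S, HasDerivAt (fun t ↦ U t v) v' 0) (u : E) (k : ℕ) :
    ∀ v ∈ S, ∃ w ∈ S, iteratedDeriv k (fun s ↦ ⟪u, U s v⟫_ℂ) = fun s ↦ ⟪u, U s w⟫_ℂ := by
  induction k with
  | zero => exact fun v hv ↦ ⟨v, hv, iteratedDeriv_zero⟩
  | succ k ih =>
    intro v hv
    obtain ⟨v', hv', hd⟩ := hS v hv
    obtain ⟨w, hw, hk⟩ := ih v' hv'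
    refine ⟨w, hw, ?_⟩
    rw [iteratedDeriv_succ', ← hk]
    congr 1
    funext s
    exact (hasDerivAt_inner_oneParam U hU hd u s).deriv

omit [NormedSpace ℝ E] [IsScalarTower ℝ ℂ E] in
/-- **A real-analytic function on `ℝ` all of whose iterated derivatives vanish at `0` is zero**:
near `0` it is the sum of its Taylor series (`HasFPowerSeriesOnBall.hasSum_iteratedFDeriv`,
`iteratedFDeriv_apply_eq_iteratedDeriv_mul_prod`), which vanishes, and a real-analytic function
on the connected line vanishing near a point vanishes identically
(`AnalyticOnNhd.eqOn_zero_of_preconnected_of_eventuallyEq_zero`). Harish-Chandra 1953, proof of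
the Corollary to Thm. 2 (p. 211). [folklore] -/
theorem eq_zero_of_iteratedDeriv_eq_zero {F : ℝ → ℂ} (ha : ∀ t, AnalyticAt ℝ F t)
    (h0 : ∀ k, iteratedDeriv k F 0 = 0) : F = 0 := by
  -- near `0`, `F` is the sum of its Taylor series, which vanishes
  have hloc : F =ᶠ[𝓝 0] 0 := by
    obtain ⟨p, r, hp⟩ := ha 0
    have hr := hp.r_pos
    rw [Filter.eventuallyEq_iff_exists_mem]
    refine ⟨Metric.eball 0 r, Metric.eball_mem_nhds 0 hr, fun y hy ↦ ?_⟩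
    have hsum := hp.hasSum_iteratedFDeriv (y := y) (by simpa using hy)
    have hzero : (fun n ↦ (n.factorial : ℝ)⁻¹ • iteratedFDeriv ℝ n F 0 fun _ ↦ y) = fun _ ↦ 0 := by
      funext n
      rw [iteratedFDeriv_apply_eq_iteratedDeriv_mul_prod, h0, smul_zero, smul_zero]
    rw [hzero, zero_add] at hsum
    exact (hasSum_zero.unique hsum).symm ▸ rfl
  have hon : AnalyticOnNhd ℝ F Set.univ := fun t _ ↦ ha t
  have h := hon.eqOn_zero_of_preconnected_of_eventuallyEq_zero isPreconnected_univ
    (Set.mem_univ 0) hloc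
  funext t
  exact h (Set.mem_univ t)

variable [CompleteSpace E]

/-- **Closure invariance from analyticity of orbits** (Harish-Chandra 1953, Corollary to
Thm. 2, p. 211, abstract form along a one-parameter group; Libine 2012, Cor. 73). Let
`U : ℝ → (E →L[ℂ] E)` satisfy `U (s + t) = U s ∘ U t`, `U 0 = id`, on the complex Hilbert
space `E`, and let `S ≤ E` be a subspace such that every `v ∈ S` has a derivative
`d/dt|₀ U t v ∈ S` and a real-analytic orbit `t ↦ U t v`. Then `U t (Cl S) ⊆ Cl S` for every
`t`: for `v ∈ S` and `u ⊥ Cl S` the analytic function `s ↦ ⟪u, U s v⟫` has iterated derivatives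
`⟪u, U 0 w_k⟫ = ⟪u, w_k⟫ = 0` at `0` (`w_k ∈ S`, `exists_iteratedDeriv_inner_oneParam_eq`), hence
vanishes identically (`eq_zero_of_iteratedDeriv_eq_zero`), so `U t v ∈ (Cl S)ᗮᗮ = Cl S`
(`Submodule.orthogonal_orthogonal`); the closure follows by continuity of `U t`. [cite: HarishChandraTAMS1953, Cor. to Thm. 2 (p. 211)] -/
theorem topologicalClosure_invariant_of_analyticAt (U : ℝ → E →L[ℂ] E)
    (hU : ∀ s t v, U (s + t) v = U s (U t v)) (hU0 : ∀ v, U 0 v = v) (S : Submodule ℂ E)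
    (hS : ∀ v ∈ S, ∃ v' ∈ S, HasDerivAt (fun t ↦ U t v) v' 0)
    (ha : ∀ v ∈ S, ∀ t₀ : ℝ, AnalyticAt ℝ (fun t ↦ U t v) t₀) (t : ℝ) :
    ∀ v ∈ S.topologicalClosure, U t v ∈ S.topologicalClosure := by
  -- first for `v ∈ S`: all matrix coefficients against `(Cl S)ᗮ` vanish identically
  have hmem : ∀ v ∈ S, U t v ∈ S.topologicalClosure := by
    intro v hv
    rw [← Submodule.orthogonal_orthogonal S.topologicalClosure, Submodule.mem_orthogonal]
    intro u hu
    have hF : (fun s ↦ ⟪u, U s v⟫_ℂ) = 0 := by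
      refine eq_zero_of_iteratedDeriv_eq_zero (fun s ↦ ?_) (fun k ↦ ?_)
      · exact (((innerSL ℂ u).restrictScalars ℝ).analyticAt _).comp (ha v hv s)
      · obtain ⟨w, hw, hk⟩ := exists_iteratedDeriv_inner_oneParam_eq U hU S hS u k v hv
        rw [hk]
        show ⟪u, U 0 w⟫_ℂ = 0
        rw [hU0]
        exact Submodule.inner_left_of_mem_orthogonal (S.le_topologicalClosure hw) hu
    exact congrFun hF t
  -- then for the closure, by continuity of `U t`
  intro v hv
  have hmaps : Set.MapsTo (U t) (S : Set E) (S.topologicalClosure : Set E) := fun v hv ↦ hmem v hv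
  have hcl := hmaps.closure (U t).continuous
  rw [S.isClosed_topologicalClosure.closure_eq, ← Submodule.topologicalClosure_coe] at hcl
  exact hcl hv

end Hilbert

end Literature.NumberTheory.Automorphic
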